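import Summits.FinalStateConjecture.FinalStateConjecture.Theses.ZeroEnergyKerrOrBomb
import Literature.Geometry.Lorentzian.TameGenericityDiagonal
import Literature.Geometry.Lorentzian.TameGenericityLocalWindow
import HarnessLib

/-!
# Strategist sketch (crux-strategist s1, 2026-08-17) — crux `FinalStateFromKerrOrBomb`
# (stmt-FinalStateConjecture-17839, route ZeroEnergyKerrOrBomb rev 9)

Census artefacts, kernel-checked:

* §1 DECOMPOSITION (the filed one): `FinalStateFromKerrOrBomb ⇐ WeakCosmicCensorshipTame →
  FinalStateRelCensorshipFromKerrOrBomb`, glue `finalStateFromKerrOrBomb_of_subs` over the tree's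
  composition-along-curves lemma `InitialDataSet.isTameChristodoulouGeneric_of_relative_exceptional`
  (TameGenericityDiagonal.lean). Child 1 is VERBATIM the shared item PhaseMixingCapture.WeakCosmicCensorshipTame
  (stmt-17269); child 2 is the crux RELATIVE TO CENSORSHIP (exceptional-base hand-back of summit-good
  curves along censored curves), with the route's target `KerrOrBombModT` kept as antecedent.
  `finalStateRelCensorship_of_crux_of_wcc` certifies that, given child 1, child 2 loses nothing.
* §2 STRENGTHEN: `CruxPointwiseCensored` (X → every CENSORED admissible datum satisfies the summit
  property pointwise) — the rigid form under which WCC enters by monotonicity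
  (`crux_of_pointwiseCensored`); believed FALSE under the route's own thesis (a bomb hole's own
  development is censored and does not settle to Kerr), recorded as a definition.
* §3 NEGATION kill shape: `not_isTameChristodoulouGeneric_of_wDist_nhds` — a bad admissible datum with a
  `wDist`-NEIGHBOURHOOD of bad data on every end refutes tame genericity (the typed obstruction a
  'stable dark attractor' / 'open extremal formation' witness would feed); folklore over TameGenericity.lean.
-/

set_option linter.dupNamespace false
set_option maxSynthPendingDepth 3

noncomputable section

namespace Summit.FinalStateConjecture.FinalStateConjecture.Theses.ZeroEnergyKerrOrBomb

open scoped BigOperators Topology Manifold Classical ENNReal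
open Filter Set Function TopologicalSpace

/-! ## §1 The split: WCC (shared) + the crux relative to censorship -/

/-- CHILD 1 — verbatim `PhaseMixingCapture.WeakCosmicCensorshipTame` (stmt-FinalStateConjecture-17269):
TAME weak cosmic censorship in MGHD form. -/
def WeakCosmicCensorshipTame : Prop :=
  ∀ (X : Type) [TopologicalSpace X] [ChartedSpace Literature.Geometry.Lorentzian.E3 X] [IsManifold (𝓡 3) ((⊤ : ℕ∞) : WithTop ℕ∞) X] [T2Space X] [SecondCountableTopology X] [ConnectedSpace X], Literature.Geometry.Lorentzian.InitialDataSet.IsTameChristodoulouGeneric (Literature.Geometry.Lorentzian.admissibleVacuumData X) (fun D ↦ (∃ 𝒟 : Literature.Geometry.Lorentzian.VacuumCauchyDevelopment D, 𝒟.IsMaximal) ∧ ∀ 𝒟 : Literature.Geometry.Lorentzian.VacuumCauchyDevelopment D, 𝒟.IsMaximal → Summit.FinalStateConjecture.HasCompleteNullInfinity 𝒟.toCauchyDevelopment) 1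

/-- CHILD 2 — THE CRUX RELATIVE TO CENSORSHIP: given the target `KerrOrBombModT`, along every tame
curve `F` of admissible data on an end `e` (immersed at `0` and injective, or constant) whose members
off `0` are CENSORED (an MGHD exists and every MGHD has complete `𝓘⁺`) and whose base datum `F 0` is
EXCEPTIONAL for the summit property, there passes a tame, injective, immersed curve `F'` of admissible
data through the same base datum (`F' 0 = F 0`, on some end `e'`) all of whose members off `0` satisfy
the summit property (MGHD exists; every MGHD has complete `𝓘⁺` and an honest sub-extremal `C²`
final-state decomposition: `exteriorOf`, `RaysStayInClosure`, `HasExhaustiveCharts`, `IsFutureOriented`).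
Constant branch = censored-but-exceptional data are curable; curve branch = a censorship-escape curve
through an uncensored exceptional datum upgrades to a final-state-escape curve. -/
def FinalStateRelCensorshipFromKerrOrBomb : Prop :=
  KerrOrBombModT → ∀ (X : Type) [TopologicalSpace X] [ChartedSpace Literature.Geometry.Lorentzian.E3 X] [IsManifold (𝓡 3) ((⊤ : ℕ∞) : WithTop ℕ∞) X] [T2Space X] [SecondCountableTopology X] [ConnectedSpace X], ∀ (e : Literature.Geometry.Lorentzian.AFEnd X) (F : EuclideanSpace ℝ (Fin 1) → Literature.Geometry.Lorentzian.InitialDataSet (𝓡 3) X), Literature.Geometry.Lorentzian.InitialDataSet.IsTameDataFamily e 1 F → ((Literature.Geometry.Lorentzian.InitialDataSet.IsImmersedAtZero 1 F ∧ Function.Injective F) ∨ ∀ c, F c = F 0) → (∀ c, F c ∈ Literature.Geometry.Lorentzian.admissibleVacuumData X) → (∀ c ≠ 0, (∃ 𝒟 : Literature.Geometry.Lorentzian.VacuumCauchyDevelopment (F c), 𝒟.IsMaximal) ∧ ∀ 𝒟 : Literature.Geometry.Lorentzian.VacuumCauchyDevelopment (F c), 𝒟.IsMaximal → Summit.FinalStateConjecture.HasCompleteNullInfinity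 𝒟.toCauchyDevelopment) → ¬ ((∃ 𝒟 : Literature.Geometry.Lorentzian.VacuumCauchyDevelopment (F 0), 𝒟.IsMaximal) ∧ ∀ 𝒟 : Literature.Geometry.Lorentzian.VacuumCauchyDevelopment (F 0), 𝒟.IsMaximal → Summit.FinalStateConjecture.HasCompleteNullInfinity 𝒟.toCauchyDevelopment ∧ ∃ (O : Set 𝒟.carrier) (d : Literature.Geometry.Lorentzian.FinalStateDecomposition 𝒟.toSpacetime O 2), (∀ i, Literature.Geometry.Lorentzian.Kerr.IsSubextremal (d.mass i) (d.spin i)) ∧ O = Summit.FinalStateConjecture.exteriorOf 𝒟.toCauchyDevelopment d.charted ∧ Summit.FinalStateConjecture.RaysStayInClosure 𝒟.toCauchyDevelopment O ∧ Summit.FinalStateConjecture.HasExhaustiveCharts d ∧ Summit.FinalStateConjecture.IsFutureOriented d) → ∃ (e' : Literature.Geometry.Lorentzian.AFEnd X) (F' : EuclideanSpace ℝ (Fin 1) → Literature.Geometry.Lorentzian.InitialDataSet (𝓡 3) X), Literature.Geometry.Lorentzian.InitialDataSet.IsTameDataFamily e' 1 F' ∧ F' 0 = F 0 ∧ Function.Injective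 F' ∧ Literature.Geometry.Lorentzian.InitialDataSet.IsImmersedAtZero 1 F' ∧ (∀ c, F' c ∈ Literature.Geometry.Lorentzian.admissibleVacuumData X) ∧ ∀ c ≠ 0, (∃ 𝒟 : Literature.Geometry.Lorentzian.VacuumCauchyDevelopment (F' c), 𝒟.IsMaximal) ∧ ∀ 𝒟 : Literature.Geometry.Lorentzian.VacuumCauchyDevelopment (F' c), 𝒟.IsMaximal → Summit.FinalStateConjecture.HasCompleteNullInfinity 𝒟.toCauchyDevelopment ∧ ∃ (O : Set 𝒟.carrier) (d : Literature.Geometry.Lorentzian.FinalStateDecomposition 𝒟.toSpacetime O 2), (∀ i, Literature.Geometry.Lorentzian.Kerr.IsSubextremal (d.mass i) (d.spin i)) ∧ O = Summit.FinalStateConjecture.exteriorOf 𝒟.toCauchyDevelopment d.charted ∧ Summit.FinalStateConjecture.RaysStayInClosure 𝒟.toCauchyDevelopment O ∧ Summit.FinalStateConjecture.HasExhaustiveCharts d ∧ Summit.FinalStateConjecture.IsFutureOriented d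

/-- GLUE of the split: generic hypotheses enter generic conclusions along curves
(`isTameChristodoulouGeneric_of_relative_exceptional`), never by conjunction; every admissible
datum has a sole strongly asymptotically flat end by definition of the admissible class. -/
theorem finalStateFromKerrOrBomb_of_subs (h₁ : WeakCosmicCensorshipTame)
    (h₂ : FinalStateRelCensorshipFromKerrOrBomb) : FinalStateFromKerrOrBomb := by
  intro hX X _ _ _ _ _ _
  refine Literature.Geometry.Lorentzian.InitialDataSet.isTameChristodoulouGeneric_of_relative_exceptional
    ?_ (h₁ X) (h₂ hX X)
  intro d hd
  obtain ⟨-, e, M, hsole, hdecay⟩ := id hd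
  exact ⟨e, hsole, M, hdecay⟩

/-- LOSSLESS: given child 1, child 2 follows from the crux (the relative form with exceptional base is
tame genericity read at the base datum, `exists_curve_of_isTameChristodoulouGeneric_of_not`). Hence,
modulo WCC, the split is an equivalence: child 2 is exactly "the crux minus weak cosmic censorship". -/
theorem finalStateRelCensorship_of_crux (h : FinalStateFromKerrOrBomb) :
    FinalStateRelCensorshipFromKerrOrBomb := by
  intro hX X _ _ _ _ _ _ e F hF hdich hadm hQ hexc
  exact Literature.Geometry.Lorentzian.InitialDataSet.exists_curve_of_isTameChristodoulouGeneric_of_not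
    (Q := fun D ↦ (∃ 𝒟 : Literature.Geometry.Lorentzian.VacuumCauchyDevelopment D, 𝒟.IsMaximal) ∧
      ∀ 𝒟 : Literature.Geometry.Lorentzian.VacuumCauchyDevelopment D, 𝒟.IsMaximal →
        Summit.FinalStateConjecture.HasCompleteNullInfinity 𝒟.toCauchyDevelopment)
    (h hX X) e F hF hdich hadm hQ hexc

/-! ## §2 STRENGTHEN: the pointwise-in-the-censored-regime form -/

/-- S⁺ — POINTWISE settling of CENSORED data, given the target: every admissible datum with an MGHD
all of whose MGHDs have complete `𝓘⁺` satisfies the summit property outright. The rigid form under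
which weak cosmic censorship enters by MONOTONICITY (`crux_of_pointwiseCensored`). Believed FALSE: a
Killing-mode-UNSTABLE stationary vacuum hole (the bomb branch of the route's own dichotomy) has a
censored development that settles to a non-Kerr hole; critical (threshold) data form exactly extremal
horizons (Kehle–Unger); far-field focusing packets defeat pointwise `C²` settling (predecessor
Disproof §7). X = `KerrOrBombModT` is precisely too weak here: pointwise settling needs rigidity of
ALL presentable stationary holes, not of the mode-stable ones. Recorded as a definition. -/
def CruxPointwiseCensored : Prop :=
  KerrOrBombModT → ∀ (X : Type) [TopologicalSpace X] [ChartedSpace Literature.Geometry.Lorentzian.E3 X] [IsManifold (𝓡 3) ((⊤ : ℕ∞) : WithTop ℕ∞) X] [T2Space X] [SecondCountableTopology X] [ConnectedSpace X], ∀ D ∈ Literature.Geometry.Lorentzian.admissibleVacuumData X, ((∃ 𝒟 : Literature.Geometry.Lorentzian.VacuumCauchyDevelopment D, 𝒟.IsMaximal) ∧ ∀ 𝒟 : Literature.Geometry.Lorentzian.VacuumCauchyDevelopment D, 𝒟.IsMaximal → Summit.FinalStateConjecture.HasCompleteNullInfinity 𝒟.toCauchyDevelopment) → (∃ 𝒟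 : Literature.Geometry.Lorentzian.VacuumCauchyDevelopment D, 𝒟.IsMaximal) ∧ ∀ 𝒟 : Literature.Geometry.Lorentzian.VacuumCauchyDevelopment D, 𝒟.IsMaximal → Summit.FinalStateConjecture.HasCompleteNullInfinity 𝒟.toCauchyDevelopment ∧ ∃ (O : Set 𝒟.carrier) (d : Literature.Geometry.Lorentzian.FinalStateDecomposition 𝒟.toSpacetime O 2), (∀ i, Literature.Geometry.Lorentzian.Kerr.IsSubextremal (d.mass i) (d.spin i)) ∧ O = Summit.FinalStateConjecture.exteriorOf 𝒟.toCauchyDevelopment d.charted ∧ Summit.FinalStateConjecture.RaysStayInClosure 𝒟.toCauchyDevelopment O ∧ Summit.FinalStateConjecture.HasExhaustiveCharts d ∧ Summit.FinalStateConjecture.IsFutureOriented d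

/-- Under S⁺ the relative child is immediate: along a censored curve the members off `0` are censored,
hence (S⁺) summit-good — the incoming curve itself is the witness when it is immersed and injective;
when it is constant its base is censored, hence summit-good, contradicting exceptionality. -/
theorem finalStateRelCensorship_of_pointwiseCensored (h : CruxPointwiseCensored) :
    FinalStateRelCensorshipFromKerrOrBomb := by
  intro hX X _ _ _ _ _ _ e F hF hdich hadm hQ hexc
  rcases hdich with ⟨himm, hinj⟩ | hconst
  · exact ⟨e, F, hF, rfl, hinj, himm, hadm, fun c hc ↦ h hX X (F c) (hadm c) (hQ c hc)⟩
  · exfalso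
    -- constant curve: `F 1 = F 0` is censored (as a member off `0`), hence summit-good by S⁺
    have hQ0 := hQ (EuclideanSpace.single 0 1) (by simp)
    rw [hconst] at hQ0
    exact hexc (h hX X (F 0) (hadm 0) hQ0)

/-- … so S⁺ and WCC give the crux by pure logic (what the pointwise rigidity would buy). -/
theorem crux_of_pointwiseCensored (h : CruxPointwiseCensored) (hW : WeakCosmicCensorshipTame) :
    FinalStateFromKerrOrBomb :=
  finalStateFromKerrOrBomb_of_subs hW (finalStateRelCensorship_of_pointwiseCensored h)

/-! ## §3 NEGATION: the kill shape an OPEN set of bad data would feed -/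

/-- **A `wDist`-neighbourhood of exceptional data kills tame genericity.** If `d ∈ 𝓓` fails `P` and,
on EVERY asymptotically flat end `e` of `X`, all data of `𝓓` within some positive weighted distance
`e.wDist · d < δ` of `d` fail `P` too, then `P` is not tame-Christodoulou-generic in `𝓓` (any
codimension `m ≥ 1`): a tame family through `d` is `wDist`-continuous at `0` on its end, so its members
near `0` — some of them with non-zero parameter — are exceptional. This is the typed obstruction a
'stable non-Kerr attractor' (an open basin of data settling to a non-Kerr hole) or 'open extremal
formation' would instantiate against the T2 summit. [folklore] -/
theorem not_isTameChristodoulouGeneric_of_wDist_nhds {X : Type} [TopologicalSpace X]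
    [ChartedSpace Literature.Geometry.Lorentzian.E3 X] [IsManifold (𝓡 3) ((⊤ : ℕ∞) : WithTop ℕ∞) X]
    {𝓓 : Set (Literature.Geometry.Lorentzian.InitialDataSet (𝓡 3) X)}
    {P : Literature.Geometry.Lorentzian.InitialDataSet (𝓡 3) X → Prop}
    {d : Literature.Geometry.Lorentzian.InitialDataSet (𝓡 3) X} (hd : d ∈ 𝓓) (hPd : ¬ P d)
    (h : ∀ e : Literature.Geometry.Lorentzian.AFEnd X, ∃ δ : ℝ≥0∞, 0 < δ ∧
      ∀ D' ∈ 𝓓, e.wDist D' d < δ → ¬ P D')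
    {m : ℕ} (hm : m ≠ 0) :
    ¬ Literature.Geometry.Lorentzian.InitialDataSet.IsTameChristodoulouGeneric 𝓓 P m := by
  intro hG
  obtain ⟨e, F, hF, -, h0, -, hF𝓓, hgood⟩ := hG d ⟨hd, hPd⟩
  obtain ⟨δ, hδ, hbad⟩ := h e
  -- `wDist (F c) (F 0) → 0`, so eventually `< δ`
  have hev : ∀ᶠ c in 𝓝 (0 : EuclideanSpace ℝ (Fin m)), e.wDist (F c) (F 0) < δ :=
    hF.2.2.2.eventually (gt_mem_nhds hδ)
  -- a non-zero parameter in that neighbourhood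
  haveI : Nontrivial (EuclideanSpace ℝ (Fin m)) := by
    haveI : Nonempty (Fin m) := ⟨⟨0, Nat.pos_of_ne_zero hm⟩⟩
    infer_instance
  haveI : (𝓝[≠] (0 : EuclideanSpace ℝ (Fin m))).NeBot := Module.punctured_nhds_neBot ℝ _ 0
  have hev' : ∀ᶠ c in 𝓝[≠] (0 : EuclideanSpace ℝ (Fin m)),
      e.wDist (F c) (F 0) < δ ∧ c ∈ ({0}ᶜ : Set (EuclideanSpace ℝ (Fin m))) :=
    (hev.filter_mono nhdsWithin_le_nhds).and self_mem_nhdsWithin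
  obtain ⟨c, hc, hcne⟩ := hev'.exists
  have hcne' : c ≠ 0 := by simpa using hcne
  have hlt : e.wDist (F c) d < δ := by simpa [h0] using hc
  exact hgood c hcne' ⟨hF𝓓 c, hbad (F c) (hF𝓓 c) hlt⟩

end Summit.FinalStateConjecture.FinalStateConjecture.Theses.ZeroEnergyKerrOrBomb

end
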